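import Mathlib
import Summits.ValiantsHypothesis.ValiantsHypothesis.Theorems.KPlusLogSqLawWeakLiftingTowerGraftSkewBlockCornerMixing
import Summits.ValiantsHypothesis.ValiantsHypothesis.Theorems.KPlusLogSqLawWeakLiftingTowerGraftSkewBlockAxisPairEvents

/-!
# Tower graft line — THE TWO-SCALE MIXING: a Descartes-sharp block pencil, mixed so that one Gram minor dominates another at every root

Calibration file for the line `Cruxes/WeakLifting/Lines/tower_graft.lean` (crux `WeakLifting` = stmt-ValiantsHypothesis-19561); feeds
`…SkewBlockAxisPairSharp.lean` (the indefinite axis-pair no-go).  NO stub is claimed.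

* `exists_sharp_mixing_certificate` — the data inside p708005's `skewBlock_cornerGraft_of_sharp`, exported: a square block pencil `B` with
  `det B ≠ 0` Descartes-sharp (`#supp(det B) ≤ Z₊(det B) + 1`) admits a unipotent mixing `P` (det 1) and interleaved positive points
  `τ₀ < ρ₀ < τ₁ < ⋯ < ρ_{N−1} < τ_N` (`N = Z₊(det B)`) with `det(B(τᵣ)P) ≠ 0`, `det(B(ρᵣ)P) = 0` and `B(ρᵣ)P` minus column `0` of full column
  rank (sorted roots + midpoints; p704766 sharp ⇒ simple ⇒ corank one; p708005 moment mixing).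
* `gram_det_mul_diagonal_submatrix` — Gram minors under a diagonal column rescaling.
* ★ `exists_dominant_mixing` — THE TWO-SCALE MIXING: `P' = P·diag(1, δ⁻¹, …, δ⁻¹)` with `δ` small (one `δ` below every root's threshold
  `δ²·Gramᵢ < Gram₀`) makes the `0`-deleted Gram minor of `B(ρᵣ)P'` STRICTLY DOMINATE the `i`-deleted one at every root (`i ≠ 0`), with
  `det P' ≠ 0` and the root / non-root certificate preserved — exactly the hypothesis of `skewBlock_axisPair_crossings`.

HONEST FRAMING: linear algebra + real-closedness bookkeeping; nothing on S4/S4b/S5/S5ᴸ, TowerB, `WeakLifting`, Conjecture B, `MatrixDescartes`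
(18050) or `VP ≠ VNP`.  Def-free.  Seat: prover val-sym-lift-p2 g21, `--supports stmt-ValiantsHypothesis-19561`.
-/

-- `Summit.ValiantsHypothesis.ValiantsHypothesis.…` repeats a component by the D-0017 layout
-- (single-conjunct summit), which the `dupNamespace` linter flags; the name is mandated.
set_option linter.dupNamespace false

namespace Summit.ValiantsHypothesis.ValiantsHypothesis.Theorems.KPlusLogSqLaw.TowerGraft

open Polynomial Matrix
open scoped BigOperators Polynomial

section AxisPairMixing

/-- **THE MIXING CERTIFICATE** (the data inside `skewBlock_cornerGraft_of_sharp`, exported): a Descartes-sharp square block pencil admits a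
unipotent mixing `P` (det 1) and interleaved positive points `τ₀ < ρ₀ < τ₁ < ⋯ < ρ_{N−1} < τ_N`, `N = Z₊(det B)`, with `det(B(τᵣ)P) ≠ 0`,
`det(B(ρᵣ)P) = 0` and `B(ρᵣ)P` minus column `0` of full column rank. [this work] -/
theorem exists_sharp_mixing_certificate {q K : ℕ} (d : Fin K → ℕ) (B : Fin K → Matrix (Fin (q + 1)) (Fin (q + 1)) ℝ)
    (hdet : (∑ l, (X : ℝ[X]) ^ d l • (B l).map C).det ≠ 0)
    (hsharp : (∑ l, (X : ℝ[X]) ^ d l • (B l).map C).det.support.card ≤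
      ((∑ l, (X : ℝ[X]) ^ d l • (B l).map C).det.roots.toFinset.filter (fun t => 0 < t)).card + 1) :
    ∃ (P : Matrix (Fin (q + 1)) (Fin (q + 1)) ℝ) (τ ρ : ℕ → ℝ), P.det = 1 ∧ (∀ r, τ r < ρ r) ∧ (∀ r, ρ r < τ (r + 1)) ∧ (∀ r, 0 < τ r) ∧
      (∀ r, r ≤ ((∑ l, (X : ℝ[X]) ^ d l • (B l).map C).det.roots.toFinset.filter (fun t => 0 < t)).card →
        (∑ l, τ r ^ d l • (B l * P)).det ≠ 0) ∧
      (∀ r, r < ((∑ l, (X : ℝ[X]) ^ d l • (B l).map C).det.roots.toFinset.filter (fun t => 0 < t)).card →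
        (∑ l, ρ r ^ d l • (B l * P)).det = 0) ∧
      (∀ r, r < ((∑ l, (X : ℝ[X]) ^ d l • (B l).map C).det.roots.toFinset.filter (fun t => 0 < t)).card →
        (((∑ l, ρ r ^ d l • (B l * P)).submatrix id (0 : Fin (q + 1)).succAbove)ᵀ *
          ((∑ l, ρ r ^ d l • (B l * P)).submatrix id (0 : Fin (q + 1)).succAbove)).det ≠ 0) := by
  classical
  set M : Matrix (Fin (q + 1)) (Fin (q + 1)) ℝ[X] := ∑ l, (X : ℝ[X]) ^ d l • (B l).map C with hM
  set f : ℝ[X] := M.det with hf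
  set R : Finset ℝ := f.roots.toFinset.filter (fun t => 0 < t) with hR
  set N : ℕ := R.card with hN
  have hmemR : ∀ x : ℝ, x ∈ R ↔ f.eval x = 0 ∧ 0 < x := fun x => by
    simp only [hR, Finset.mem_filter, Multiset.mem_toFinset, Polynomial.mem_roots hdet, Polynomial.IsRoot.def]
  have hfeval : ∀ t : ℝ, f.eval t = (∑ l, t ^ d l • B l).det := fun t => by rw [hf, hM, eval_det_pencil_of_fintype]
  -- the sorted positive roots, extended to a strictly increasing sequence on `ℕ` (as in `skewBlock_identityGraft_of_sharp`)
  set e := R.orderEmbOfFin hN.symm with he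
  set M₀ : ℝ := ∑ x ∈ R, x with hM₀
  have hRpos : ∀ x ∈ R, 0 < x := fun x hx => ((hmemR x).mp hx).2
  have hM₀ge : ∀ x ∈ R, x ≤ M₀ := fun x hx =>
    Finset.single_le_sum (f := fun x => x) (fun y hy => (hRpos y hy).le) hx
  have hM₀nn : 0 ≤ M₀ := Finset.sum_nonneg fun y hy => (hRpos y hy).le
  set ρ : ℕ → ℝ := fun i => if h : i < N then e ⟨i, h⟩ else M₀ + ((i + 1 - N : ℕ) : ℝ) with hρ
  have hρe : ∀ (i : ℕ) (h : i < N), ρ i = e ⟨i, h⟩ := fun i h => by simp only [hρ, dif_pos h]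
  have hρmem : ∀ (i : ℕ), i < N → ρ i ∈ R := fun i h => by rw [hρe i h]; exact Finset.orderEmbOfFin_mem _ _ _
  have hρstep : ∀ i, ρ i < ρ (i + 1) := by
    intro i
    by_cases h1 : i + 1 < N
    · rw [hρe i (by omega), hρe (i + 1) h1]
      exact e.strictMono (Fin.mk_lt_mk.mpr (Nat.lt_succ_self i))
    · by_cases h2 : i < N
      · rw [hρe i h2]
        simp only [hρ, dif_neg h1]
        have : (i + 1 + 1 - N : ℕ) = 1 := by omega
        rw [this, Nat.cast_one]
        linarith [hM₀ge _ (Finset.orderEmbOfFin_mem R hN.symm ⟨i, h2⟩)]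
      · simp only [hρ, dif_neg h1, dif_neg h2]
        have : ((i + 1 + 1 - N : ℕ) : ℝ) = ((i + 1 - N : ℕ) : ℝ) + 1 := by
          rw [show (i + 1 + 1 - N : ℕ) = (i + 1 - N) + 1 by omega]; push_cast; ring
        rw [this]; linarith
  have hρmono : StrictMono ρ := strictMono_nat_of_lt_succ hρstep
  have hρ0 : 0 < ρ 0 := by
    by_cases h : 0 < N
    · exact hRpos _ (hρmem 0 h)
    · simp only [hρ, dif_neg h]
      have : (0 + 1 - N : ℕ) = 1 := by omega
      rw [this, Nat.cast_one]; linarith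
  have hρpos : ∀ i, 0 < ρ i := fun i => lt_of_lt_of_le hρ0 (hρmono.monotone (Nat.zero_le i))
  set τ : ℕ → ℝ := fun i => if i = 0 then ρ 0 / 2 else (ρ (i - 1) + ρ i) / 2 with hτ
  have hτ0 : τ 0 = ρ 0 / 2 := by simp [hτ]
  have hτS : ∀ i, τ (i + 1) = (ρ i + ρ (i + 1)) / 2 := fun i => by simp [hτ]
  have hτρ : ∀ i, τ i < ρ i := by
    intro i
    rcases i with _ | i
    · rw [hτ0]; linarith [hρ0]
    · rw [hτS]; linarith [hρstep i]
  have hρτ : ∀ i, ρ i < τ (i + 1) := fun i => by rw [hτS]; linarith [hρstep i]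
  have hτpos : ∀ i, 0 < τ i := by
    intro i
    rcases i with _ | i
    · rw [hτ0]; linarith [hρ0]
    · rw [hτS]; linarith [hρpos i, hρpos (i + 1)]
  have hτB : ∀ i, i ≤ N → (∑ l, τ i ^ d l • B l).det ≠ 0 := by
    intro i hi h0
    have hmem : τ i ∈ R := (hmemR _).mpr ⟨by rw [hfeval]; exact h0, hτpos i⟩
    obtain ⟨j, hj⟩ : ∃ j : Fin N, e j = τ i := by
      have : τ i ∈ Set.range e := by rw [he, Finset.range_orderEmbOfFin]; exact hmem
      exact this
    rcases i with _ | i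
    · have h1 : e ⟨0, j.pos⟩ ≤ e j := e.monotone (Fin.mk_le_mk.mpr (Nat.zero_le _))
      rw [hj, ← hρe 0 j.pos] at h1
      linarith [hτρ 0]
    · have hlo : ρ i < e j := by rw [hj]; exact hρτ i
      have hhi : e j < ρ (i + 1) := by rw [hj]; exact hτρ (i + 1)
      rw [hρe i (by omega)] at hlo
      have hij : (⟨i, by omega⟩ : Fin N) < j := e.lt_iff_lt.mp hlo
      by_cases h2 : i + 1 < N
      · rw [hρe (i + 1) h2] at hhi
        have hji : j < ⟨i + 1, h2⟩ := e.lt_iff_lt.mp hhi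
        rw [Fin.lt_def] at hij hji
        simp only at hij hji
        omega
      · have := j.isLt
        rw [Fin.lt_def] at hij
        simp only at hij
        omega
  have hρB : ∀ i, i < N → (∑ l, ρ i ^ d l • B l).det = 0 := fun i hi => by
    rw [← hfeval]; exact ((hmemR _).mp (hρmem i hi)).1
  -- a kernel generator at every root (sharp ⇒ some column-deleted matrix has full rank ⇒ corank one)
  have hgen : ∀ i, i < N → ∃ u : Fin (q + 1) → ℝ, u ≠ 0 ∧
      ∀ v, (∑ l, ρ i ^ d l • B l) *ᵥ v = 0 → ∃ r : ℝ, v = r • u := by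
    intro i hi
    have h := exists_gram_det_ne_zero_of_sharp M hdet hsharp (hρpos i) (by
      rw [Polynomial.IsRoot.def, ← hf]; exact ((hmemR _).mp (hρmem i hi)).1)
    rw [hM, lacunaryPencil_map_eval] at h
    obtain ⟨u, hu0, -, hker⟩ := exists_kernel_generator _ (hρB i hi) h
    exact ⟨u, hu0, hker⟩
  -- choose the generators, then one moment functional avoiding all of them
  set U : ℕ → Fin (q + 1) → ℝ := fun i => if h : i < N then Classical.choose (hgen i h) else fun _ => 1 with hU
  have hU0 : ∀ i, i < N → U i ≠ 0 := fun i hi => by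
    simp only [hU, dif_pos hi]; exact (Classical.choose_spec (hgen i hi)).1
  have hUker : ∀ i, i < N → ∀ v, (∑ l, ρ i ^ d l • B l) *ᵥ v = 0 → ∃ r : ℝ, v = r • U i := fun i hi => by
    simp only [hU, dif_pos hi]; exact (Classical.choose_spec (hgen i hi)).2
  obtain ⟨c, hc⟩ := exists_moment_ne_zero N U hU0
  set P : Matrix (Fin (q + 1)) (Fin (q + 1)) ℝ :=
    Matrix.of fun i k : Fin (q + 1) => if i = k then (1 : ℝ) else if i = 0 then -(c ^ (k : ℕ)) else 0 with hP
  have hPdet : P.det = 1 := det_mixMatrix c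
  -- the mixed block pencil: same determinant, full column rank off column `0` at every root
  have hmix : ∀ t : ℝ, (∑ l, t ^ d l • (B l * P)) = (∑ l, t ^ d l • B l) * P := fun t => sum_smul_mul_right d B P t
  have hτB' : ∀ i, i ≤ N → (∑ l, τ i ^ d l • (B l * P)).det ≠ 0 := fun i hi => by
    rw [hmix, Matrix.det_mul, hPdet, mul_one]; exact hτB i hi
  have hρB' : ∀ i, i < N → (∑ l, ρ i ^ d l • (B l * P)).det = 0 := fun i hi => by
    rw [hmix, Matrix.det_mul, hρB i hi, zero_mul]
  have hρB'' : ∀ i, i < N → (((∑ l, ρ i ^ d l • (B l * P)).submatrix id (0 : Fin (q + 1)).succAbove)ᵀ *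
      ((∑ l, ρ i ^ d l • (B l * P)).submatrix id (0 : Fin (q + 1)).succAbove)).det ≠ 0 := fun i hi => by
    rw [hmix]
    exact gram_det_mul_mix_ne_zero _ (U i) (hUker i hi) c (hc i hi)
  exact ⟨P, τ, ρ, hPdet, hτρ, hρτ, hτpos, hτB', hρB', hρB''⟩

/-- Gram determinants scale under a diagonal column scaling restricted off one column. [folklore] -/
theorem gram_det_mul_diagonal_submatrix {p q : ℕ} (A : Matrix (Fin p) (Fin (q + 1)) ℝ) (w : Fin (q + 1) → ℝ) (k : Fin (q + 1)) :
    (((A * Matrix.diagonal w).submatrix id k.succAbove)ᵀ * (A * Matrix.diagonal w).submatrix id k.succAbove).det =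
      (∏ l, w (k.succAbove l)) ^ 2 * ((A.submatrix id k.succAbove)ᵀ * A.submatrix id k.succAbove).det := by
  rw [mul_diagonal_submatrix, Matrix.transpose_mul, Matrix.diagonal_transpose, Matrix.mul_assoc, Matrix.det_mul,
    ← Matrix.mul_assoc, Matrix.det_mul, Matrix.det_diagonal]
  simp only [Function.comp]
  ring

/-- **THE TWO-SCALE MIXING**: from the certificate (column `0` of `B(ρᵣ)P` survives at every root), a diagonal rescaling
`P' = P · diag(1, δ⁻¹, …, δ⁻¹)` with `δ` small makes the `0`-deleted Gram minor DOMINATE the `i`-deleted one at every root (`i ≠ 0`),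
keeping `det P' ≠ 0` and the root/non-root certificate. [this work] -/
theorem exists_dominant_mixing {q K : ℕ} (d : Fin K → ℕ) (B : Fin K → Matrix (Fin (q + 1)) (Fin (q + 1)) ℝ) (N : ℕ)
    (P : Matrix (Fin (q + 1)) (Fin (q + 1)) ℝ) (τ ρ : ℕ → ℝ) (hP : P.det = 1)
    (hτB : ∀ r, r ≤ N → (∑ l, τ r ^ d l • (B l * P)).det ≠ 0)
    (hρB : ∀ r, r < N → (∑ l, ρ r ^ d l • (B l * P)).det = 0)
    (hρB'' : ∀ r, r < N → (((∑ l, ρ r ^ d l • (B l * P)).submatrix id (0 : Fin (q + 1)).succAbove)ᵀ *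
      ((∑ l, ρ r ^ d l • (B l * P)).submatrix id (0 : Fin (q + 1)).succAbove)).det ≠ 0)
    (i : Fin (q + 1)) (hi : i ≠ 0) :
    ∃ P' : Matrix (Fin (q + 1)) (Fin (q + 1)) ℝ, P'.det ≠ 0 ∧
      (∀ r, r ≤ N → ((∑ l, τ r ^ d l • (B l * P'))ᵀ * (∑ l, τ r ^ d l • (B l * P'))).det ≠ 0) ∧
      (∀ r, r < N → ((∑ l, ρ r ^ d l • (B l * P'))ᵀ * (∑ l, ρ r ^ d l • (B l * P'))).det = 0) ∧
      (∀ r, r < N → (((∑ l, ρ r ^ d l • (B l * P')).submatrix id i.succAbove)ᵀ *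
          ((∑ l, ρ r ^ d l • (B l * P')).submatrix id i.succAbove)).det <
        (((∑ l, ρ r ^ d l • (B l * P')).submatrix id (0 : Fin (q + 1)).succAbove)ᵀ *
          ((∑ l, ρ r ^ d l • (B l * P')).submatrix id (0 : Fin (q + 1)).succAbove)).det) := by
  classical
  -- the Gram minors at the roots, before rescaling
  set A : ℕ → Matrix (Fin (q + 1)) (Fin (q + 1)) ℝ := fun r => ∑ l, ρ r ^ d l • (B l * P) with hA
  set G₀ : ℕ → ℝ := fun r => (((A r).submatrix id (0 : Fin (q + 1)).succAbove)ᵀ * (A r).submatrix id (0 : Fin (q + 1)).succAbove).det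
    with hG₀
  set Gᵢ : ℕ → ℝ := fun r => (((A r).submatrix id i.succAbove)ᵀ * (A r).submatrix id i.succAbove).det with hGᵢ
  have hG₀pos : ∀ r, r < N → 0 < G₀ r := fun r hr =>
    lt_of_le_of_ne (posSemidef_transpose_mul_self _).det_nonneg (Ne.symm (hρB'' r hr))
  have hGᵢnn : ∀ r, 0 ≤ Gᵢ r := fun r => (posSemidef_transpose_mul_self _).det_nonneg
  -- one `δ` with `δ² Gᵢ r < G₀ r` for all `r < N`
  set b : ℕ → ℝ := fun r => G₀ r / (Gᵢ r + 1) with hb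
  have hbpos : ∀ r, r < N → 0 < b r := fun r hr => div_pos (hG₀pos r hr) (by linarith [hGᵢnn r])
  obtain ⟨g, hgpos, hgle⟩ : ∃ g : ℝ, 0 < g ∧ ∀ r, r < N → g ≤ b r := by
    by_cases hN : N = 0
    · exact ⟨1, one_pos, fun r hr => by omega⟩
    · have hne : ((Finset.range N).image b).Nonempty := ⟨b 0, Finset.mem_image.mpr ⟨0, Finset.mem_range.mpr (by omega), rfl⟩⟩
      refine ⟨((Finset.range N).image b).min' hne, ?_, fun r hr => Finset.min'_le _ _ (Finset.mem_image.mpr ⟨r, Finset.mem_range.mpr hr, rfl⟩)⟩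
      rw [Finset.lt_min'_iff]
      intro y hy
      obtain ⟨r, hr, rfl⟩ := Finset.mem_image.mp hy
      exact hbpos r (Finset.mem_range.mp hr)
  set δ : ℝ := min (1 / 2) (g / 2) with hδ
  have hδpos : 0 < δ := by rw [hδ]; exact lt_min (by norm_num) (by linarith)
  have hδhalf : δ ≤ 1 / 2 := min_le_left _ _
  have hδg : δ ≤ g / 2 := min_le_right _ _
  have hδsq : ∀ r, r < N → δ ^ 2 * Gᵢ r < G₀ r := by
    intro r hr
    have h1 : δ ^ 2 ≤ δ * (1 / 2) := by rw [sq]; exact mul_le_mul_of_nonneg_left hδhalf hδpos.le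
    have h2 : δ ^ 2 < g := by nlinarith
    have h3 : g * (Gᵢ r + 1) ≤ G₀ r := by
      have := hgle r hr
      rw [hb] at this
      exact (le_div_iff₀ (by linarith [hGᵢnn r])).mp this
    nlinarith [hGᵢnn r]
  -- the rescaling
  set w : Fin (q + 1) → ℝ := fun k => if k = 0 then 1 else δ⁻¹ with hw
  have hwpos : ∀ k, 0 < w k := fun k => by
    by_cases hk : k = 0
    · simp [hw, hk]
    · simp [hw, hk, hδpos]
  set P' := P * Matrix.diagonal w with hP'
  have hdetD : (Matrix.diagonal w).det ≠ 0 := by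
    rw [Matrix.det_diagonal]; exact Finset.prod_ne_zero_iff.mpr fun k _ => (hwpos k).ne'
  have hP'det : P'.det ≠ 0 := by rw [hP', Matrix.det_mul, hP, one_mul]; exact hdetD
  have hBP' : ∀ t : ℝ, (∑ l, t ^ d l • (B l * P')) = (∑ l, t ^ d l • (B l * P)) * Matrix.diagonal w := by
    intro t
    rw [sum_smul_mul_right, sum_smul_mul_right, hP', Matrix.mul_assoc]
  refine ⟨P', hP'det, fun r hr => ?_, fun r hr => ?_, fun r hr => ?_⟩
  · rw [det_transpose_mul_self_eq_sq, hBP', Matrix.det_mul]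
    exact pow_ne_zero _ (mul_ne_zero (hτB r hr) hdetD)
  · rw [det_transpose_mul_self_eq_sq, hBP', Matrix.det_mul, hρB r hr, zero_mul, zero_pow two_ne_zero]
  · rw [hBP', gram_det_mul_diagonal_submatrix, gram_det_mul_diagonal_submatrix]
    -- `∏ w ∘ i.succAbove = δ⁻¹ ∏ w ∘ 0.succAbove`... via `∏_k w k = w i · ∏ (w ∘ i.succAbove) = w 0 · ∏ (w ∘ 0.succAbove)`
    have hprod_i : ∏ l, w (i.succAbove l) = δ * ∏ l, w ((0 : Fin (q + 1)).succAbove l) := by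
      have h1 := Fin.prod_univ_succAbove w i
      have h2 := Fin.prod_univ_succAbove w 0
      have hwi : w i = δ⁻¹ := by rw [hw]; simp [hi]
      have hw0 : w 0 = 1 := by rw [hw]; simp
      rw [hwi] at h1
      rw [hw0, one_mul] at h2
      have : ∏ l, w (i.succAbove l) = δ * (δ⁻¹ * ∏ l, w (i.succAbove l)) := by
        rw [← mul_assoc, mul_inv_cancel₀ hδpos.ne', one_mul]
      rw [this, ← h1, h2]
    rw [hprod_i, mul_pow]
    have hc : 0 < (∏ l, w ((0 : Fin (q + 1)).succAbove l)) ^ 2 := pow_pos (Finset.prod_pos fun l _ => hwpos _) 2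
    have key := hδsq r hr
    simp only [hG₀, hGᵢ, hA] at key
    nlinarith [key, hc, mul_lt_mul_of_pos_left key hc]

end AxisPairMixing

end Summit.ValiantsHypothesis.ValiantsHypothesis.Theorems.KPlusLogSqLaw.TowerGraft
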